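import Literature.NumberTheory.Automorphic.UnitaryLatticeTreeFixedCosetStrataDictionary   -- (this seat, companion): §1 `ncard_fixedBy_quotient_sep_eq_ncard_selfDual_fixed_sep`, §2 level tokens ↔ `rank(red u − 1)`, `rank N(u)`, `N(u)²`, §3 nilpotency ∕ ranks
import HarnessLib

/-!
# Fixed cosets of `U(σ,H) ⧸ U ∩ GL_N(𝒪)` ↔ fixed self-dual lattices: the CLASS token (`∃ y ∈ M, |ϖ⁻¹B_H(y,(γ−1)y) − c·a²| < 1` ↔ `∃ z̄ ā ≠ 0, z̄ᵀ(H̄ N(u))z̄ = c̄ ā²`)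
# and the FIVE two-layer strata counts `#{uK_U ∈ Fix_γ : label_j(u⁻¹γu)} = #{M self-dual : γM = M ∧ LABEL_j(M)}` (bd ∕ 0 ∕ reg ∕ 1□_c ∕ its complement)

Topic `NumberTheory/Automorphic`; namespace `Literature.NumberTheory.Automorphic.UnitaryLatticeTree`.  THEOREMS ONLY (no definition, no instance, no notation, no named fact, no `sorry`).
Hand F0P3a-p05 (g16), 2026-09-02.  Cell `pub/hodgecm-mathlib`, crux H413 = `stmt-HodgeConjecture-24833`; road «S3-ram» (LEAD F0P3a-plan (g12); owner∕table F0P3a-p06 (g15)); architect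
A-p16 (g31) ROAD-P1ram v2 row «A1′ COUNT TRANSPORT» (p05), PART 2 = model cosets → lattices; companion of `UnitaryLatticeTreeFixedCosetStrataDictionary` (§1–§3 there).
COSET labels (★ p847257, on `u := (out q)⁻¹ γ (out q)`): bd `rank(red u − 1) = 2`; 0 `rank(red u − 1) = 0 ∧ rank N(u) = 0`; reg `… ∧ rank N(u) = 2`; 1□_c `… ∧ rank N(u) = 1 ∧ ∃ z̄ ā, ā ≠ 0 ∧
z̄ᵀ(H̄ N(u)) z̄ = red c · ā²` (and its negation), `N(u) = red(ϖ⁻¹(u − 1))`, `H̄ = red H`.  LATTICE labels ((a2) sheet of F0P3a-p01 (g16) = ★ p847249 §5): `LEV c :≡ (γ − 1)M ⊆ c·M`,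
`LEV₂ c :≡ (γ − 1)²M ⊆ c·M`, `CLS c :≡ ∃ y ∈ M, ∃ a, |a| = 1 ∧ |ϖ⁻¹·B_H(y, (γ − 1)y) − c·a²| < 1`; bd `¬ LEV ϖ`; 0 `LEV ϖ²`; reg `LEV ϖ ∧ ¬ LEV ϖ² ∧ ¬ LEV₂ ϖ³`;
1□_c `LEV ϖ ∧ ¬ LEV ϖ² ∧ LEV₂ ϖ³ ∧ CLS c` (complement: `… ∧ ¬ CLS c`).

THE MATHEMATICS ([Kottwitz1986] §3; [Rogawski1990] §4.9 pp. 54–55).  §4: for `g ∈ U = U(σ, H)` and `u = g⁻¹γg`, `B_H(g z, (γ − 1) g z) = ᵗσz ᵗσg H g (u − 1) z = ϖ · B_H(z, ϖ⁻¹(u − 1) z)` (★ p847249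
`exists_mem_mapGL_class_iff` with `ᵗσg H g = H`); for `σ` an isometry that is RESIDUALLY TRIVIAL (`|σx − x| < 1` on `𝒪` — the ramified quadratic case) and `H`, `N := ϖ⁻¹(u − 1)` integral, the value
`B_H(z, Nz) ∈ 𝒪` reduces entrywise to `z̄ᵀ(H̄ N̄) z̄`, and `|V − c a²| < 1, |a| = 1` is `V̄ = c̄ ā², ā ≠ 0`; lifting residue vectors back to `𝒪^N` gives the equivalence.  §5: the HYPOTHESES are (i) `L₀`
self-dual and `U` transitive on self-dual lattices (★ for `J₀`, `|2| = 1`), (ii) `γ` normalised `v`-deep (`γ ≡ 1 (ϖ²)`), (iii) for «bd» only, NO TRANSVECTIONS: `rank(red u − 1) ≠ 1` for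
residually unipotent `u ∈ U ∩ GL_3(𝒪)` (holds when `red U ⊆ O_3`, odd residue characteristic — supplied by the caller, e.g. ★ p847117 at a CM place); then label by label: `rank(red u − 1) ∈ {0, 2}`
(nilpotent, no transvection) with `= 0 ⟺ LEV ϖ`; on ROW 0, `rank N = 0 ⟺ LEV ϖ²`, `N² = 0 ⟺ LEV₂ ϖ³`, `N³ = 0` so `rank N = 2 ⟺ N² ≠ 0` and `rank N = 1 ⟺ N² = 0 ∧ N ≠ 0`; and the class
token by §4.  Each count identity is then ONE application of the predicate-generic bijection (companion §1).
HONEST LABEL: HC_CM is proved only modulo the 2 remaining named inputs (hLiu418 24832, h413 24833) until rung 0 closes; no books consequence.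

## References
* [Kottwitz1986] R. E. Kottwitz, *Base change for unit elements of Hecke algebras*, Compositio Math. 60 (1986): §3 (fixed points of `γ` on the building; the congruence filtration).
* [Rogawski1990] J. D. Rogawski, *Automorphic Representations of Unitary Groups in Three Variables*, Ann. of Math. Stud. 123 (1990): §4.9 pp. 54–55 (orbital integrals of `1_K` as lattice counts; the strata).
* [Serre1980Trees] J.-P. Serre, *Trees* (1980): Ch. II §1.1 (lattices and `GL_N(K) ⧸ GL_N(𝒪)`).
* [BruhatTits1972] F. Bruhat, J. Tits, *Groupes réductifs sur un corps local I*, Publ. Math. IHÉS 41 (1972): §10 (self-dual lattice classes as vertices).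
-/

set_option autoImplicit false

noncomputable section

open Matrix ValuativeRel Literature.NumberTheory.Automorphic Literature.NumberTheory.Automorphic.IntegralReduction Literature.GroupTheory.SpecificGroups
open Literature.NumberTheory.Automorphic.HermitianLattice Literature.NumberTheory.Automorphic.UnitaryGroup
open scoped Matrix MatrixGroups WithZero ValuativeRel

namespace Literature.NumberTheory.Automorphic.UnitaryLatticeTree

variable {K : Type*} [Field K] [Valued K ℤᵐ⁰] [ValuativeRel K] [(Valued.v : Valuation K ℤᵐ⁰).Compatible] {N : ℕ}

/-! ## §4 The class token at a vertex `g·L₀`, `g ∈ U`: residual quadratic values of `H̄ · N(g⁻¹γg)` (σ residually trivial) -/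

omit [Valued K ℤᵐ⁰] [(Valued.v : Valuation K ℤᵐ⁰).Compatible] in
/-- The residue of `x ∈ 𝒪` is non-zero iff `|x| = 1` (`ValuativeRel` currency; companion of ★ `residue_eq_zero_iff_valuation_lt_one`, `IwahoriGL`). [cite: Serre1980Trees, Ch. II §1.1] -/
theorem residue_ne_zero_iff_valuation_eq_one (x : 𝒪[K]) : IsLocalRing.residue 𝒪[K] x ≠ 0 ↔ valuation K (x : K) = 1 := by
  rw [Ne, residue_eq_zero_iff_valuation_lt_one, not_lt]
  have hle : valuation K (x : K) ≤ 1 := (Valuation.mem_integer_iff _ _).1 x.2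
  exact ⟨fun h => le_antisymm hle h, fun h => h.ge⟩

/-- A residually trivial `σ` (`|σx − x| < 1` on `𝒪`) induces the identity on residues: `res(σ x) = res x`. [cite: Rogawski1990, §4.9 p. 54] -/
theorem residue_integerMap_eq_of_residuallyTrivial (σ : K →+* K) (hσv : ∀ x, valuation K (σ x) = valuation K x)
    (hres : ∀ x : K, Valued.v x ≤ 1 → Valued.v (σ x - x) < 1) (x : 𝒪[K]) :
    IsLocalRing.residue 𝒪[K] (integerMap σ hσv x) = IsLocalRing.residue 𝒪[K] x := by
  rw [← sub_eq_zero, ← map_sub, residue_eq_zero_iff_valuation_lt_one, ← v_lt_one_iff_valuation_lt_one]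
  exact hres _ ((v_le_one_iff_mem_integer _).2 x.2)

omit [Valued K ℤᵐ⁰] [ValuativeRel K] [(Valued.v : Valuation K ℤᵐ⁰).Compatible] in
/-- `ϖ⁻¹ · B_H(y, (u − 1) y) = B_H(y, ϖ⁻¹(u − 1) y)`. [cite: Rogawski1990, §4.9 p. 54] -/
theorem inv_mul_pairing_sub_one_mulVec (σ : K →+* K) (H : Matrix (Fin N) (Fin N) K) (ϖ : K) (X : Matrix (Fin N) (Fin N) K) (y : Fin N → K) :
    ϖ⁻¹ * pairing σ H y (X *ᵥ y) = pairing σ H y ((ϖ⁻¹ • X) *ᵥ y) := by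
  rw [Matrix.smul_mulVec, map_smul, smul_eq_mul]

omit [Valued K ℤᵐ⁰] [(Valued.v : Valuation K ℤᵐ⁰).Compatible] in
/-- **THE VALUE `B_H(y, N y)` ON `𝒪^N`, LIFTED TO `𝒪`**: for `H₀, N₀` over `𝒪` and `y₀ ∈ 𝒪^N`, `B_H(y₀, N₀ y₀) = Σ σ(y₀ᵢ) H₀ᵢⱼ (N₀y₀)ⱼ ∈ 𝒪`. [cite: Rogawski1990, §4.9 p. 54] -/
theorem pairing_mapMatrix_mulVec_eq_coe (σ : K →+* K) (hσv : ∀ x, valuation K (σ x) = valuation K x) (H₀ N₀ : Matrix (Fin N) (Fin N) 𝒪[K]) (y₀ : Fin N → 𝒪[K]) :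
    pairing σ ((𝒪[K]).subtype.mapMatrix H₀) (fun i => (y₀ i : K)) (((𝒪[K]).subtype.mapMatrix N₀) *ᵥ fun i => (y₀ i : K)) =
      ((∑ i, ∑ j, integerMap σ hσv (y₀ i) * H₀ i j * (N₀ *ᵥ y₀) j : 𝒪[K]) : K) := by
  have hmv : ((𝒪[K]).subtype.mapMatrix N₀) *ᵥ (fun i => (y₀ i : K)) = fun j => (((N₀ *ᵥ y₀) j : 𝒪[K]) : K) := by
    funext j; exact (RingHom.map_mulVec (𝒪[K]).subtype N₀ y₀ j).symm
  rw [hmv, pairing_apply]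
  push_cast
  simp only [RingHom.mapMatrix_apply, Matrix.map_apply, coe_integerMap_apply, Subring.coe_subtype]

/-- **ITS RESIDUE**: `res(Σ σ(y₀ᵢ) H₀ᵢⱼ (N₀y₀)ⱼ) = ȳ₀ᵀ (H̄₀ N̄₀) ȳ₀` when `σ` is residually trivial. [cite: Rogawski1990, §4.9 p. 54] -/
theorem residue_pairingSum_eq_dotProduct (σ : K →+* K) (hσv : ∀ x, valuation K (σ x) = valuation K x)
    (hres : ∀ x : K, Valued.v x ≤ 1 → Valued.v (σ x - x) < 1) (H₀ N₀ : Matrix (Fin N) (Fin N) 𝒪[K]) (y₀ : Fin N → 𝒪[K]) :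
    IsLocalRing.residue 𝒪[K] (∑ i, ∑ j, integerMap σ hσv (y₀ i) * H₀ i j * (N₀ *ᵥ y₀) j) =
      (fun i => IsLocalRing.residue 𝒪[K] (y₀ i)) ⬝ᵥ (((IsLocalRing.residue 𝒪[K]).mapMatrix H₀ * (IsLocalRing.residue 𝒪[K]).mapMatrix N₀) *ᵥ fun i => IsLocalRing.residue 𝒪[K] (y₀ i)) := by
  have hmv : (IsLocalRing.residue 𝒪[K]).mapMatrix N₀ *ᵥ (fun i => IsLocalRing.residue 𝒪[K] (y₀ i)) = fun j => IsLocalRing.residue 𝒪[K] ((N₀ *ᵥ y₀) j) := by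
    funext j; exact (RingHom.map_mulVec (IsLocalRing.residue 𝒪[K]) N₀ y₀ j).symm
  rw [← Matrix.mulVec_mulVec, hmv]
  simp only [map_sum, map_mul, residue_integerMap_eq_of_residuallyTrivial σ hσv hres, dotProduct, Matrix.mulVec, RingHom.mapMatrix_apply,
    Matrix.map_apply, Finset.mul_sum, mul_assoc]

/-- **THE CLASS TOKEN ON `𝒪^N` IS A RESIDUAL SQUARE-CLASS CONDITION**: for integral `H, N′`, `|c| ≤ 1` and `σ` residually trivial,
`(∃ y ∈ 𝒪^N, ∃ a, |a| = 1 ∧ |B_H(y, N′y) − c·a²| < 1) ⟺ ∃ z̄ ā, ā ≠ 0 ∧ z̄ᵀ(H̄ N̄′) z̄ = c̄·ā²`. [cite: Rogawski1990, §4.9 p. 54] [cite: Kottwitz1986, §3] -/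
theorem exists_mem_stdLattice_class_iff_residue (σ : K →+* K) (hvσ : ∀ a, Valued.v (σ a) = Valued.v a)
    (hres : ∀ x : K, Valued.v x ≤ 1 → Valued.v (σ x - x) < 1) {H N' : Matrix (Fin N) (Fin N) K} (hH : ValBound 1 H) (hN' : ValBound 1 N')
    {c : K} (hc : Valued.v c ≤ 1) :
    (∃ y ∈ stdLattice K N, ∃ a : K, Valued.v a = 1 ∧ Valued.v (pairing σ H y (N' *ᵥ y) - c * a ^ 2) < 1) ↔
      ∃ (z : Fin N → 𝓀[K]) (a : 𝓀[K]), a ≠ 0 ∧ z ⬝ᵥ ((redMat H * redMat N') *ᵥ z) = red c * a ^ 2 := by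
  have hσv : ∀ x, valuation K (σ x) = valuation K x := fun x => (v_eq_iff_valuation_eq _ _).1 (hvσ x)
  obtain ⟨H₀, rfl⟩ := exists_mapMatrix_eq_of_valBound_one hH
  obtain ⟨N₀, rfl⟩ := exists_mapMatrix_eq_of_valBound_one hN'
  obtain ⟨c₀, rfl⟩ : ∃ c₀ : 𝒪[K], (c₀ : K) = c := ⟨⟨c, (v_le_one_iff_mem_integer c).1 hc⟩, rfl⟩
  rw [redMat_mapMatrix, redMat_mapMatrix, red_coe]
  constructor
  · rintro ⟨y, hy, a, ha, hlt⟩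
    have hyO : ∀ i, y i ∈ 𝒪[K] := fun i => (v_le_one_iff_mem_integer _).1 (mem_stdLattice.1 hy i)
    set y₀ : Fin N → 𝒪[K] := fun i => ⟨y i, hyO i⟩ with hy₀
    have hyy : y = fun i => (y₀ i : K) := rfl
    set a₀ : 𝒪[K] := ⟨a, (v_le_one_iff_mem_integer a).1 ha.le⟩ with ha₀
    refine ⟨fun i => IsLocalRing.residue 𝒪[K] (y₀ i), IsLocalRing.residue 𝒪[K] a₀, (residue_ne_zero_iff_valuation_eq_one a₀).2 ((v_eq_one_iff_valuation_eq_one _).1 ha), ?_⟩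
    rw [← residue_pairingSum_eq_dotProduct σ hσv hres H₀ N₀ y₀]
    have hval : pairing σ ((𝒪[K]).subtype.mapMatrix H₀) y (((𝒪[K]).subtype.mapMatrix N₀) *ᵥ y) - (c₀ : K) * a ^ 2 =
        (((∑ i, ∑ j, integerMap σ hσv (y₀ i) * H₀ i j * (N₀ *ᵥ y₀) j) - c₀ * a₀ ^ 2 : 𝒪[K]) : K) := by
      rw [hyy, pairing_mapMatrix_mulVec_eq_coe σ hσv H₀ N₀ y₀]; push_cast; rw [ha₀]
    rw [hval, v_lt_one_iff_valuation_lt_one, ← residue_eq_zero_iff_valuation_lt_one, map_sub, sub_eq_zero, map_mul, map_pow] at hlt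
    exact hlt
  · rintro ⟨z, ab, hab, heq⟩
    obtain ⟨y₀, hy₀⟩ : ∃ y₀ : Fin N → 𝒪[K], (fun i => IsLocalRing.residue 𝒪[K] (y₀ i)) = z :=
      ⟨fun i => (IsLocalRing.residue_surjective (z i)).choose, funext fun i => (IsLocalRing.residue_surjective (z i)).choose_spec⟩
    obtain ⟨a₀, rfl⟩ := IsLocalRing.residue_surjective ab
    subst hy₀
    refine ⟨fun i => (y₀ i : K), mem_stdLattice.2 fun i => (v_le_one_iff_mem_integer _).2 (y₀ i).2, (a₀ : K), (v_eq_one_iff_valuation_eq_one _).2 ((residue_ne_zero_iff_valuation_eq_one a₀).1 hab), ?_⟩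
    have hval : pairing σ ((𝒪[K]).subtype.mapMatrix H₀) (fun i => (y₀ i : K)) (((𝒪[K]).subtype.mapMatrix N₀) *ᵥ fun i => (y₀ i : K)) - (c₀ : K) * (a₀ : K) ^ 2 =
        (((∑ i, ∑ j, integerMap σ hσv (y₀ i) * H₀ i j * (N₀ *ᵥ y₀) j) - c₀ * a₀ ^ 2 : 𝒪[K]) : K) := by
      rw [pairing_mapMatrix_mulVec_eq_coe σ hσv H₀ N₀ y₀]; push_cast; rfl
    rw [hval, v_lt_one_iff_valuation_lt_one, ← residue_eq_zero_iff_valuation_lt_one, map_sub, sub_eq_zero, map_mul, map_pow, residue_pairingSum_eq_dotProduct σ hσv hres H₀ N₀ y₀]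
    exact heq

/-- **THE CLASS TOKEN AT A VERTEX `g·L₀`, `g ∈ U(σ, H)`**: for `u := g⁻¹γg ∈ GL_N(𝒪)` on ROW 0 (so `N(u) = red(ϖ⁻¹(u − 1))` is an integral reduction), `H` integral, `|c| ≤ 1`, `σ` an
isometry that is residually trivial: `(∃ y ∈ g·L₀, ∃ a, |a| = 1 ∧ |ϖ⁻¹·B_H(y, (γ − 1)y) − c·a²| < 1) ⟺ ∃ z̄ ā, ā ≠ 0 ∧ z̄ᵀ(H̄ · N(u)) z̄ = red c · ā²` (★ p847249
`exists_mem_mapGL_class_iff` moves to `L₀` with the form `ᵗσg H g = H`; then §4's residue dictionary). [cite: Rogawski1990, §4.9 p. 54] [cite: Kottwitz1986, §3] -/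
theorem exists_mem_mapGL_class_iff_residue (σ : K →+* K) (hvσ : ∀ a, Valued.v (σ a) = Valued.v a)
    (hres : ∀ x : K, Valued.v x ≤ 1 → Valued.v (σ x - x) < 1) {H : Matrix (Fin N) (Fin N) K} (hH : IsIntMatrix H)
    {ϖ : K} (hϖ : Valued.v ϖ = WithZero.exp (-1 : ℤ)) (γ g : ↥(unitaryGroupOfForm σ H))
    (hu : ((g⁻¹ * γ * g : ↥(unitaryGroupOfForm σ H)) : GL (Fin N) K) ∈ glInt N K)
    (hr0 : (redMat (((g⁻¹ * γ * g : ↥(unitaryGroupOfForm σ H)) : GL (Fin N) K) : Matrix (Fin N) (Fin N) K) - 1).rank = 0) {c : K} (hc : Valued.v c ≤ 1) :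
    (∃ y ∈ mapGL ((g : ↥(unitaryGroupOfForm σ H)) : GL (Fin N) K) (stdLattice K N), ∃ a : K, Valued.v a = 1 ∧
        Valued.v (ϖ⁻¹ * pairing σ H y (((((γ : ↥(unitaryGroupOfForm σ H)) : GL (Fin N) K) : Matrix (Fin N) (Fin N) K) - 1) *ᵥ y) - c * a ^ 2) < 1) ↔
      ∃ (z : Fin N → 𝓀[K]) (a : 𝓀[K]), a ≠ 0 ∧
        z ⬝ᵥ ((redMat H * redMat (ϖ⁻¹ • ((((g⁻¹ * γ * g : ↥(unitaryGroupOfForm σ H)) : GL (Fin N) K) : Matrix (Fin N) (Fin N) K) - 1))) *ᵥ z) = red c * a ^ 2 := by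
  have hγ : ((γ : ↥(unitaryGroupOfForm σ H)) : GL (Fin N) K) =
      ((g : ↥(unitaryGroupOfForm σ H)) : GL (Fin N) K) * ((g⁻¹ * γ * g : ↥(unitaryGroupOfForm σ H)) : GL (Fin N) K) * ((g : ↥(unitaryGroupOfForm σ H)) : GL (Fin N) K)⁻¹ := by
    rw [Subgroup.coe_mul, Subgroup.coe_mul, Subgroup.coe_inv]; group
  have hfc : formCongr σ ((g : ↥(unitaryGroupOfForm σ H)) : GL (Fin N) K) H = H := mem_unitaryGroupOfForm_iff.1 g.2
  rw [hγ, exists_mem_mapGL_class_iff, hfc]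
  have hHv : ValBound 1 H := fun i j => (v_le_one_iff_valuation_le_one _).1 (hH i j)
  have hNint := valBound_inv_smul_sub_one_of_rank_eq_zero hϖ hu hr0
  rw [← exists_mem_stdLattice_class_iff_residue σ hvσ hres hHv hNint hc]
  refine exists_congr fun y => and_congr_right fun _ => exists_congr fun a => and_congr_right fun _ => ?_
  rw [inv_mul_pairing_sub_one_mulVec]

/-! ## §5 The five two-layer strata counts: fixed cosets of `U ⧸ U ∩ GL₃(𝒪)` = fixed self-dual lattices with the (a2) labels -/

section Counts

/-- **STRATUM «bd»**: `#{uK_U ∈ Fix_γ : rank(red(u⁻¹γu) − 1) = 2} = #{M self-dual : γM = M ∧ ¬ (γ − 1)M ⊆ ϖM}` (`γ` normalised `v`-deep; NO-TRANSVECTION guard `hguard` on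
residually unipotent elements of `U ∩ GL₃(𝒪)`). [cite: Rogawski1990, §4.9 p. 55] [cite: Kottwitz1986, §3] -/
theorem ncard_fixedBy_quotient_bd_eq_ncard_selfDual_fixed (σ : K →+* K) {ϖ : K} (hϖ : Valued.v ϖ = WithZero.exp (-1 : ℤ)) (H : Matrix (Fin 3) (Fin 3) K)
    (hL₀ : IsSelfDualLattice σ ϖ H (stdLattice K 3))
    (htrans : ∀ M : Submodule (Valued.integer K) (Fin 3 → K), IsSelfDualLattice σ ϖ H M → ∃ u : ↥(unitaryGroupOfForm σ H), M = mapGL ((u : ↥(unitaryGroupOfForm σ H)) : GL (Fin 3) K) (stdLattice K 3))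
    (γ : ↥(unitaryGroupOfForm σ H)) (hdeep : ∀ a b, Valued.v (ϖ⁻¹ * (ϖ⁻¹ * ((((γ : ↥(unitaryGroupOfForm σ H)) : GL (Fin 3) K) : Matrix (Fin 3) (Fin 3) K) - 1) a b)) ≤ 1)
    (hguard : ∀ u : ↥(unitaryGroupOfForm σ H), ((u : ↥(unitaryGroupOfForm σ H)) : GL (Fin 3) K) ∈ glInt 3 K → IsNilpotent (redMat (((u : ↥(unitaryGroupOfForm σ H)) : GL (Fin 3) K) : Matrix (Fin 3) (Fin 3) K) - 1) → (redMat (((u : ↥(unitaryGroupOfForm σ H)) : GL (Fin 3) K) : Matrix (Fin 3) (Fin 3) K) - 1).rank ≠ 1) :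
    {q : (↥(unitaryGroupOfForm σ H) ⧸ ((glInt 3 K).subgroupOf (unitaryGroupOfForm σ H))) | q ∈ MulAction.fixedBy (↥(unitaryGroupOfForm σ H) ⧸ ((glInt 3 K).subgroupOf (unitaryGroupOfForm σ H))) γ ∧ (redMat ((((q.out⁻¹ * γ * q.out) : ↥(unitaryGroupOfForm σ H)) : GL (Fin 3) K) : Matrix (Fin 3) (Fin 3) K) - 1).rank = 2}.ncard =
      {M : Submodule (Valued.integer K) (Fin 3 → K) | IsSelfDualLattice σ ϖ H M ∧ mapGL ((γ : ↥(unitaryGroupOfForm σ H)) : GL (Fin 3) K) M = M ∧ ¬ M.map ((Matrix.toLin' ((((γ : ↥(unitaryGroupOfForm σ H)) : GL (Fin 3) K) : Matrix (Fin 3) (Fin 3) K) - 1)).restrictScalars (Valued.integer K)) ≤ scaleLattice ϖ M}.ncard := by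
  refine ncard_fixedBy_quotient_sep_eq_ncard_selfDual_fixed_sep σ ϖ H hL₀ htrans γ (fun u => (redMat (((u : ↥(unitaryGroupOfForm σ H)) : GL (Fin 3) K) : Matrix (Fin 3) (Fin 3) K) - 1).rank = 2)
    (fun M => ¬ M.map ((Matrix.toLin' ((((γ : ↥(unitaryGroupOfForm σ H)) : GL (Fin 3) K) : Matrix (Fin 3) (Fin 3) K) - 1)).restrictScalars (Valued.integer K)) ≤ scaleLattice ϖ M) ?_
  intro g hmem
  have hmem' : ((g : ↥(unitaryGroupOfForm σ H)) : GL (Fin 3) K)⁻¹ * ((γ : ↥(unitaryGroupOfForm σ H)) : GL (Fin 3) K) * ((g : ↥(unitaryGroupOfForm σ H)) : GL (Fin 3) K) ∈ glInt 3 K := hmem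
  have e1 : (((g⁻¹ * γ * g : ↥(unitaryGroupOfForm σ H)) : GL (Fin 3) K) : Matrix (Fin 3) (Fin 3) K) = (((((g : ↥(unitaryGroupOfForm σ H)) : GL (Fin 3) K)⁻¹ * ((γ : ↥(unitaryGroupOfForm σ H)) : GL (Fin 3) K) * ((g : ↥(unitaryGroupOfForm σ H)) : GL (Fin 3) K) : GL (Fin 3) K)) : Matrix (Fin 3) (Fin 3) K) := rfl
  have h0 := rank_redMat_sub_one_eq_zero_iff_map_sub_one_le hϖ hmem'
  have hnil := redMat_sub_one_pow_eq_zero_of_vDeep hϖ hdeep hmem'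
  have hlt : (redMat (((g⁻¹ * γ * g : ↥(unitaryGroupOfForm σ H)) : GL (Fin 3) K) : Matrix (Fin 3) (Fin 3) K) - 1).rank < 3 := by rw [e1]; exact rank_lt_of_isNilpotent ⟨3, hnil⟩ (by norm_num)
  have hne1 : (redMat (((g⁻¹ * γ * g : ↥(unitaryGroupOfForm σ H)) : GL (Fin 3) K) : Matrix (Fin 3) (Fin 3) K) - 1).rank ≠ 1 := hguard _ hmem (by rw [e1]; exact ⟨3, hnil⟩)
  rw [e1] at hne1 hlt ⊢
  constructor
  · intro h2 hlev; have h := h0.2 hlev; omega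
  · intro hn; have h : (redMat (((((g : ↥(unitaryGroupOfForm σ H)) : GL (Fin 3) K)⁻¹ * ((γ : ↥(unitaryGroupOfForm σ H)) : GL (Fin 3) K) * ((g : ↥(unitaryGroupOfForm σ H)) : GL (Fin 3) K) : GL (Fin 3) K)) : Matrix (Fin 3) (Fin 3) K) - 1).rank ≠ 0 := fun h => hn (h0.1 h); omega

/-- **STRATUM «0»**: `#{uK_U ∈ Fix_γ : rank(red u − 1) = 0 ∧ rank N(u) = 0} = #{M self-dual : γM = M ∧ (γ − 1)M ⊆ ϖ²M}`. [cite: Rogawski1990, §4.9 p. 55] [cite: Kottwitz1986, §3] -/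
theorem ncard_fixedBy_quotient_deep_eq_ncard_selfDual_fixed (σ : K →+* K) {ϖ : K} (hϖ : Valued.v ϖ = WithZero.exp (-1 : ℤ)) (H : Matrix (Fin 3) (Fin 3) K)
    (hL₀ : IsSelfDualLattice σ ϖ H (stdLattice K 3))
    (htrans : ∀ M : Submodule (Valued.integer K) (Fin 3 → K), IsSelfDualLattice σ ϖ H M → ∃ u : ↥(unitaryGroupOfForm σ H), M = mapGL ((u : ↥(unitaryGroupOfForm σ H)) : GL (Fin 3) K) (stdLattice K 3))
    (γ : ↥(unitaryGroupOfForm σ H))  :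
    {q : (↥(unitaryGroupOfForm σ H) ⧸ ((glInt 3 K).subgroupOf (unitaryGroupOfForm σ H))) | q ∈ MulAction.fixedBy (↥(unitaryGroupOfForm σ H) ⧸ ((glInt 3 K).subgroupOf (unitaryGroupOfForm σ H))) γ ∧ ((redMat ((((q.out⁻¹ * γ * q.out) : ↥(unitaryGroupOfForm σ H)) : GL (Fin 3) K) : Matrix (Fin 3) (Fin 3) K) - 1).rank = 0 ∧ (redMat (ϖ⁻¹ • (((((q.out⁻¹ * γ * q.out) : ↥(unitaryGroupOfForm σ H)) : GL (Fin 3) K) : Matrix (Fin 3) (Fin 3) K) - 1))).rank = 0)}.ncard =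
      {M : Submodule (Valued.integer K) (Fin 3 → K) | IsSelfDualLattice σ ϖ H M ∧ mapGL ((γ : ↥(unitaryGroupOfForm σ H)) : GL (Fin 3) K) M = M ∧ M.map ((Matrix.toLin' ((((γ : ↥(unitaryGroupOfForm σ H)) : GL (Fin 3) K) : Matrix (Fin 3) (Fin 3) K) - 1)).restrictScalars (Valued.integer K)) ≤ scaleLattice (ϖ ^ 2) M}.ncard := by
  have hϖ0 : ϖ ≠ 0 := (isUniformizingElement_of_v_eq hϖ).ne_zero
  have hϖ1 : Valued.v ϖ ≤ 1 := by rw [hϖ, ← WithZero.exp_zero]; exact WithZero.exp_le_exp.2 (by norm_num)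
  have hϖ2 : Valued.v (ϖ ^ 2) ≤ Valued.v ϖ := by
    rw [map_pow, pow_two]; exact mul_le_of_le_one_left' hϖ1
  refine ncard_fixedBy_quotient_sep_eq_ncard_selfDual_fixed_sep σ ϖ H hL₀ htrans γ (fun u => (redMat (((u : ↥(unitaryGroupOfForm σ H)) : GL (Fin 3) K) : Matrix (Fin 3) (Fin 3) K) - 1).rank = 0 ∧ (redMat (ϖ⁻¹ • ((((u : ↥(unitaryGroupOfForm σ H)) : GL (Fin 3) K) : Matrix (Fin 3) (Fin 3) K) - 1))).rank = 0)
    (fun M => M.map ((Matrix.toLin' ((((γ : ↥(unitaryGroupOfForm σ H)) : GL (Fin 3) K) : Matrix (Fin 3) (Fin 3) K) - 1)).restrictScalars (Valued.integer K)) ≤ scaleLattice (ϖ ^ 2) M) ?_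
  intro g hmem
  have hmem' : ((g : ↥(unitaryGroupOfForm σ H)) : GL (Fin 3) K)⁻¹ * ((γ : ↥(unitaryGroupOfForm σ H)) : GL (Fin 3) K) * ((g : ↥(unitaryGroupOfForm σ H)) : GL (Fin 3) K) ∈ glInt 3 K := hmem
  have e1 : (((g⁻¹ * γ * g : ↥(unitaryGroupOfForm σ H)) : GL (Fin 3) K) : Matrix (Fin 3) (Fin 3) K) = (((((g : ↥(unitaryGroupOfForm σ H)) : GL (Fin 3) K)⁻¹ * ((γ : ↥(unitaryGroupOfForm σ H)) : GL (Fin 3) K) * ((g : ↥(unitaryGroupOfForm σ H)) : GL (Fin 3) K) : GL (Fin 3) K)) : Matrix (Fin 3) (Fin 3) K) := rfl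
  have h0 := rank_redMat_sub_one_eq_zero_iff_map_sub_one_le hϖ hmem'
  have hd := fun hr0 => rank_redMat_inv_smul_sub_one_eq_zero_iff_map_sub_one_le_sq hϖ hmem' hr0
  rw [e1]
  constructor
  · rintro ⟨hr0, hN0⟩; exact (hd hr0).1 hN0
  · intro hlev2
    have hlev : ∀ i k, Valued.v (((((((g : ↥(unitaryGroupOfForm σ H)) : GL (Fin 3) K)⁻¹ * ((γ : ↥(unitaryGroupOfForm σ H)) : GL (Fin 3) K) * ((g : ↥(unitaryGroupOfForm σ H)) : GL (Fin 3) K) : GL (Fin 3) K)) : Matrix (Fin 3) (Fin 3) K) - 1) i k) ≤ Valued.v ϖ :=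
      fun i k => ((map_sub_one_latt_le_scaleLattice_iff (pow_ne_zero 2 hϖ0) ((γ : ↥(unitaryGroupOfForm σ H)) : GL (Fin 3) K) ((g : ↥(unitaryGroupOfForm σ H)) : GL (Fin 3) K)).1 hlev2 i k).trans hϖ2
    have hr0 := h0.2 ((map_sub_one_latt_le_scaleLattice_iff hϖ0 ((γ : ↥(unitaryGroupOfForm σ H)) : GL (Fin 3) K) ((g : ↥(unitaryGroupOfForm σ H)) : GL (Fin 3) K)).2 hlev)
    exact ⟨hr0, (hd hr0).2 hlev2⟩

/-- **STRATUM «reg»**: `#{uK_U ∈ Fix_γ : rank(red u − 1) = 0 ∧ rank N(u) = 2} = #{M self-dual : γM = M ∧ (γ−1)M ⊆ ϖM ∧ ¬ ⊆ ϖ²M ∧ ¬ (γ−1)²M ⊆ ϖ³M}` (`γ` normalised `v`-deep: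
`N(u)³ = 0`, so `rank N(u) = 2 ⟺ N(u)² ≠ 0`). [cite: Rogawski1990, §4.9 p. 55] [cite: Kottwitz1986, §3] -/
theorem ncard_fixedBy_quotient_reg_eq_ncard_selfDual_fixed (σ : K →+* K) {ϖ : K} (hϖ : Valued.v ϖ = WithZero.exp (-1 : ℤ)) (H : Matrix (Fin 3) (Fin 3) K)
    (hL₀ : IsSelfDualLattice σ ϖ H (stdLattice K 3))
    (htrans : ∀ M : Submodule (Valued.integer K) (Fin 3 → K), IsSelfDualLattice σ ϖ H M → ∃ u : ↥(unitaryGroupOfForm σ H), M = mapGL ((u : ↥(unitaryGroupOfForm σ H)) : GL (Fin 3) K) (stdLattice K 3))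
    (γ : ↥(unitaryGroupOfForm σ H)) (hdeep : ∀ a b, Valued.v (ϖ⁻¹ * (ϖ⁻¹ * ((((γ : ↥(unitaryGroupOfForm σ H)) : GL (Fin 3) K) : Matrix (Fin 3) (Fin 3) K) - 1) a b)) ≤ 1) :
    {q : (↥(unitaryGroupOfForm σ H) ⧸ ((glInt 3 K).subgroupOf (unitaryGroupOfForm σ H))) | q ∈ MulAction.fixedBy (↥(unitaryGroupOfForm σ H) ⧸ ((glInt 3 K).subgroupOf (unitaryGroupOfForm σ H))) γ ∧ ((redMat ((((q.out⁻¹ * γ * q.out) : ↥(unitaryGroupOfForm σ H)) : GL (Fin 3) K) : Matrix (Fin 3) (Fin 3) K) - 1).rank = 0 ∧ (redMat (ϖ⁻¹ • (((((q.out⁻¹ * γ * q.out) : ↥(unitaryGroupOfForm σ H)) : GL (Fin 3) K) : Matrix (Fin 3) (Fin 3) K) - 1))).rank = 2)}.ncard =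
      {M : Submodule (Valued.integer K) (Fin 3 → K) | IsSelfDualLattice σ ϖ H M ∧ mapGL ((γ : ↥(unitaryGroupOfForm σ H)) : GL (Fin 3) K) M = M ∧ (M.map ((Matrix.toLin' ((((γ : ↥(unitaryGroupOfForm σ H)) : GL (Fin 3) K) : Matrix (Fin 3) (Fin 3) K) - 1)).restrictScalars (Valued.integer K)) ≤ scaleLattice ϖ M ∧ ¬ M.map ((Matrix.toLin' ((((γ : ↥(unitaryGroupOfForm σ H)) : GL (Fin 3) K) : Matrix (Fin 3) (Fin 3) K) - 1)).restrictScalars (Valued.integer K)) ≤ scaleLattice (ϖ ^ 2) M ∧ ¬ M.map ((Matrix.toLin' (((((γ : ↥(unitaryGroupOfForm σ H)) : GL (Fin 3) K) : Matrix (Fin 3) (Fin 3) K) - 1) ^ 2)).restrictScalars (Valued.integer K)) ≤ scaleLattice (ϖ ^ 3) M)}.ncard := by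
  refine ncard_fixedBy_quotient_sep_eq_ncard_selfDual_fixed_sep σ ϖ H hL₀ htrans γ (fun u => (redMat (((u : ↥(unitaryGroupOfForm σ H)) : GL (Fin 3) K) : Matrix (Fin 3) (Fin 3) K) - 1).rank = 0 ∧ (redMat (ϖ⁻¹ • ((((u : ↥(unitaryGroupOfForm σ H)) : GL (Fin 3) K) : Matrix (Fin 3) (Fin 3) K) - 1))).rank = 2)
    (fun M => M.map ((Matrix.toLin' ((((γ : ↥(unitaryGroupOfForm σ H)) : GL (Fin 3) K) : Matrix (Fin 3) (Fin 3) K) - 1)).restrictScalars (Valued.integer K)) ≤ scaleLattice ϖ M ∧ ¬ M.map ((Matrix.toLin' ((((γ : ↥(unitaryGroupOfForm σ H)) : GL (Fin 3) K) : Matrix (Fin 3) (Fin 3) K) - 1)).restrictScalars (Valued.integer K)) ≤ scaleLattice (ϖ ^ 2) M ∧ ¬ M.map ((Matrix.toLin' (((((γ : ↥(unitaryGroupOfForm σ H)) : GL (Fin 3) K) : Matrix (Fin 3) (Fin 3) K) - 1) ^ 2)).restrictScalars (Valued.integer K)) ≤ scaleLattice (ϖ ^ 3) M) ?_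
  intro g hmem
  have hmem' : ((g : ↥(unitaryGroupOfForm σ H)) : GL (Fin 3) K)⁻¹ * ((γ : ↥(unitaryGroupOfForm σ H)) : GL (Fin 3) K) * ((g : ↥(unitaryGroupOfForm σ H)) : GL (Fin 3) K) ∈ glInt 3 K := hmem
  have e1 : (((g⁻¹ * γ * g : ↥(unitaryGroupOfForm σ H)) : GL (Fin 3) K) : Matrix (Fin 3) (Fin 3) K) = (((((g : ↥(unitaryGroupOfForm σ H)) : GL (Fin 3) K)⁻¹ * ((γ : ↥(unitaryGroupOfForm σ H)) : GL (Fin 3) K) * ((g : ↥(unitaryGroupOfForm σ H)) : GL (Fin 3) K) : GL (Fin 3) K)) : Matrix (Fin 3) (Fin 3) K) := rfl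
  have h0 := rank_redMat_sub_one_eq_zero_iff_map_sub_one_le hϖ hmem'
  have hd := fun hr0 => rank_redMat_inv_smul_sub_one_eq_zero_iff_map_sub_one_le_sq hϖ hmem' hr0
  have hs := fun hr0 => redMat_inv_smul_sub_one_mul_self_eq_zero_iff_map_sub_one_sq_le hϖ hmem' hr0
  have hN3 := fun hr0 => redMat_inv_smul_sub_one_pow_eq_zero_of_vDeep hϖ hdeep hmem' hr0
  rw [e1]
  constructor
  · rintro ⟨hr0, hN2⟩
    have hsq := (rank_eq_two_iff_mul_self_ne_zero_of_pow_eq_zero (hN3 hr0)).1 hN2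
    refine ⟨h0.1 hr0, fun h => ?_, fun h => hsq ((hs hr0).2 h)⟩
    have h' := (hd hr0).2 h
    omega
  · rintro ⟨hlev, -, hnsq⟩
    have hr0 := h0.2 hlev
    exact ⟨hr0, (rank_eq_two_iff_mul_self_ne_zero_of_pow_eq_zero (hN3 hr0)).2 fun h => hnsq ((hs hr0).1 h)⟩

/-- **STRATUM «1□_c»**: `#{uK_U ∈ Fix_γ : rank(red u − 1) = 0 ∧ rank N(u) = 1 ∧ ∃ z̄ ā ≠ 0, z̄ᵀ(H̄N(u))z̄ = c̄ ā²} = #{M self-dual : γM = M ∧ LEV ϖ ∧ ¬ LEV ϖ² ∧ LEV₂ ϖ³ ∧ CLS c}`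
(`σ` residually trivial isometry, `H` integral, `|c| ≤ 1`, `γ` normalised `v`-deep). [cite: Rogawski1990, §4.9 p. 55] [cite: Kottwitz1986, §3] -/
theorem ncard_fixedBy_quotient_rankOne_eq_ncard_selfDual_fixed (σ : K →+* K) {ϖ : K} (hϖ : Valued.v ϖ = WithZero.exp (-1 : ℤ)) (H : Matrix (Fin 3) (Fin 3) K)
    (hL₀ : IsSelfDualLattice σ ϖ H (stdLattice K 3))
    (htrans : ∀ M : Submodule (Valued.integer K) (Fin 3 → K), IsSelfDualLattice σ ϖ H M → ∃ u : ↥(unitaryGroupOfForm σ H), M = mapGL ((u : ↥(unitaryGroupOfForm σ H)) : GL (Fin 3) K) (stdLattice K 3))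
    (γ : ↥(unitaryGroupOfForm σ H)) (hdeep : ∀ a b, Valued.v (ϖ⁻¹ * (ϖ⁻¹ * ((((γ : ↥(unitaryGroupOfForm σ H)) : GL (Fin 3) K) : Matrix (Fin 3) (Fin 3) K) - 1) a b)) ≤ 1)
    (hvσ : ∀ a, Valued.v (σ a) = Valued.v a) (hres : ∀ x : K, Valued.v x ≤ 1 → Valued.v (σ x - x) < 1) (hH : IsIntMatrix H) {c : K} (hc : Valued.v c ≤ 1) :
    {q : (↥(unitaryGroupOfForm σ H) ⧸ ((glInt 3 K).subgroupOf (unitaryGroupOfForm σ H))) | q ∈ MulAction.fixedBy (↥(unitaryGroupOfForm σ H) ⧸ ((glInt 3 K).subgroupOf (unitaryGroupOfForm σ H))) γ ∧ ((redMat ((((q.out⁻¹ * γ * q.out) : ↥(unitaryGroupOfForm σ H)) : GL (Fin 3) K) : Matrix (Fin 3) (Fin 3) K) - 1).rank = 0 ∧ (redMat (ϖ⁻¹ • (((((q.out⁻¹ * γ * q.out) : ↥(unitaryGroupOfForm σ H)) : GL (Fin 3) K) : Matrix (Fin 3) (Fin 3) K) - 1))).rank = 1 ∧ ∃ (z : Fin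 3 → 𝓀[K]) (a : 𝓀[K]), a ≠ 0 ∧ z ⬝ᵥ ((redMat H * redMat (ϖ⁻¹ • (((((q.out⁻¹ * γ * q.out) : ↥(unitaryGroupOfForm σ H)) : GL (Fin 3) K) : Matrix (Fin 3) (Fin 3) K) - 1))) *ᵥ z) = red c * a ^ 2)}.ncard =
      {M : Submodule (Valued.integer K) (Fin 3 → K) | IsSelfDualLattice σ ϖ H M ∧ mapGL ((γ : ↥(unitaryGroupOfForm σ H)) : GL (Fin 3) K) M = M ∧ (M.map ((Matrix.toLin' ((((γ : ↥(unitaryGroupOfForm σ H)) : GL (Fin 3) K) : Matrix (Fin 3) (Fin 3) K) - 1)).restrictScalars (Valued.integer K)) ≤ scaleLattice ϖ M ∧ ¬ M.map ((Matrix.toLin' ((((γ : ↥(unitaryGroupOfForm σ H)) : GL (Fin 3) K) : Matrix (Fin 3) (Fin 3) K) - 1)).restrictScalars (Valued.integer K)) ≤ scaleLattice (ϖ ^ 2) M ∧ M.map ((Matrix.toLin' (((((γ : ↥(unitaryGroupOfForm σ H)) : GL (Fin 3) K) : Matrix (Fin 3) (Fin 3) K) - 1) ^ 2)).restrictScalars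 (Valued.integer K)) ≤ scaleLattice (ϖ ^ 3) M ∧ ∃ y ∈ M, ∃ a : K, Valued.v a = 1 ∧ Valued.v (ϖ⁻¹ * pairing σ H y (((((γ : ↥(unitaryGroupOfForm σ H)) : GL (Fin 3) K) : Matrix (Fin 3) (Fin 3) K) - 1) *ᵥ y) - c * a ^ 2) < 1)}.ncard := by
  refine ncard_fixedBy_quotient_sep_eq_ncard_selfDual_fixed_sep σ ϖ H hL₀ htrans γ
    (fun u => (redMat (((u : ↥(unitaryGroupOfForm σ H)) : GL (Fin 3) K) : Matrix (Fin 3) (Fin 3) K) - 1).rank = 0 ∧ (redMat (ϖ⁻¹ • ((((u : ↥(unitaryGroupOfForm σ H)) : GL (Fin 3) K) : Matrix (Fin 3) (Fin 3) K) - 1))).rank = 1 ∧ ∃ (z : Fin 3 → 𝓀[K]) (a : 𝓀[K]), a ≠ 0 ∧ z ⬝ᵥ ((redMat H * redMat (ϖ⁻¹ • ((((u : ↥(unitaryGroupOfForm σ H)) : GL (Fin 3) K) : Matrix (Fin 3) (Fin 3) K) - 1))) *ᵥ z) = red c * a ^ 2)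
    (fun M => M.map ((Matrix.toLin' ((((γ : ↥(unitaryGroupOfForm σ H)) : GL (Fin 3) K) : Matrix (Fin 3) (Fin 3) K) - 1)).restrictScalars (Valued.integer K)) ≤ scaleLattice ϖ M ∧ ¬ M.map ((Matrix.toLin' ((((γ : ↥(unitaryGroupOfForm σ H)) : GL (Fin 3) K) : Matrix (Fin 3) (Fin 3) K) - 1)).restrictScalars (Valued.integer K)) ≤ scaleLattice (ϖ ^ 2) M ∧ M.map ((Matrix.toLin' (((((γ : ↥(unitaryGroupOfForm σ H)) : GL (Fin 3) K) : Matrix (Fin 3) (Fin 3) K) - 1) ^ 2)).restrictScalars (Valued.integer K)) ≤ scaleLattice (ϖ ^ 3) M ∧ ∃ y ∈ M, ∃ a : K, Valued.v a = 1 ∧ Valued.v (ϖ⁻¹ * pairing σ H y (((((γ : ↥(unitaryGroupOfForm σ H)) : GL (Fin 3) K) : Matrix (Fin 3) (Fin 3) K) - 1) *ᵥ y) - c * a ^ 2) < 1) ?_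
  intro g hmem
  have hmem' : ((g : ↥(unitaryGroupOfForm σ H)) : GL (Fin 3) K)⁻¹ * ((γ : ↥(unitaryGroupOfForm σ H)) : GL (Fin 3) K) * ((g : ↥(unitaryGroupOfForm σ H)) : GL (Fin 3) K) ∈ glInt 3 K := hmem
  have e1 : (((g⁻¹ * γ * g : ↥(unitaryGroupOfForm σ H)) : GL (Fin 3) K) : Matrix (Fin 3) (Fin 3) K) = (((((g : ↥(unitaryGroupOfForm σ H)) : GL (Fin 3) K)⁻¹ * ((γ : ↥(unitaryGroupOfForm σ H)) : GL (Fin 3) K) * ((g : ↥(unitaryGroupOfForm σ H)) : GL (Fin 3) K) : GL (Fin 3) K)) : Matrix (Fin 3) (Fin 3) K) := rfl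
  have h0 := rank_redMat_sub_one_eq_zero_iff_map_sub_one_le hϖ hmem'
  have hd := fun hr0 => rank_redMat_inv_smul_sub_one_eq_zero_iff_map_sub_one_le_sq hϖ hmem' hr0
  have hs := fun hr0 => redMat_inv_smul_sub_one_mul_self_eq_zero_iff_map_sub_one_sq_le hϖ hmem' hr0
  have hN3 := fun hr0 => redMat_inv_smul_sub_one_pow_eq_zero_of_vDeep hϖ hdeep hmem' hr0
  have hcl := fun hr0 => exists_mem_mapGL_class_iff_residue σ hvσ hres hH hϖ γ g hmem hr0 hc
  rw [e1] at hcl ⊢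
  constructor
  · rintro ⟨hr0, hN1, hcls⟩
    obtain ⟨hsq, hne⟩ := (rank_eq_one_iff_mul_self_eq_zero_and_ne_zero_of_pow_eq_zero (hN3 hr0)).1 hN1
    exact ⟨h0.1 hr0, fun h => hne ((rank_eq_zero_iff_eq_zero _).1 ((hd hr0).2 h)), (hs hr0).1 hsq, (hcl hr0).2 hcls⟩
  · rintro ⟨hlev, hn2, hlev2, hcls⟩
    have hr0 := h0.2 hlev
    refine ⟨hr0, (rank_eq_one_iff_mul_self_eq_zero_and_ne_zero_of_pow_eq_zero (hN3 hr0)).2 ⟨(hs hr0).2 hlev2, fun h => hn2 ((hd hr0).1 ?_)⟩, (hcl hr0).1 hcls⟩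
    rw [h, Matrix.rank_zero]

/-- **THE COMPLEMENTARY RANK-ONE STRATUM**: the same with `¬ ∃ z̄ ā …` ∕ `¬ CLS c` (on the rank-one locus the two classes `c`, `εc` are complementary, ★ p847189; this is the
class-free complement, consumers pick `c`). [cite: Rogawski1990, §4.9 p. 55] [cite: Kottwitz1986, §3] -/
theorem ncard_fixedBy_quotient_rankOne_not_eq_ncard_selfDual_fixed (σ : K →+* K) {ϖ : K} (hϖ : Valued.v ϖ = WithZero.exp (-1 : ℤ)) (H : Matrix (Fin 3) (Fin 3) K)
    (hL₀ : IsSelfDualLattice σ ϖ H (stdLattice K 3))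
    (htrans : ∀ M : Submodule (Valued.integer K) (Fin 3 → K), IsSelfDualLattice σ ϖ H M → ∃ u : ↥(unitaryGroupOfForm σ H), M = mapGL ((u : ↥(unitaryGroupOfForm σ H)) : GL (Fin 3) K) (stdLattice K 3))
    (γ : ↥(unitaryGroupOfForm σ H)) (hdeep : ∀ a b, Valued.v (ϖ⁻¹ * (ϖ⁻¹ * ((((γ : ↥(unitaryGroupOfForm σ H)) : GL (Fin 3) K) : Matrix (Fin 3) (Fin 3) K) - 1) a b)) ≤ 1)
    (hvσ : ∀ a, Valued.v (σ a) = Valued.v a) (hres : ∀ x : K, Valued.v x ≤ 1 → Valued.v (σ x - x) < 1) (hH : IsIntMatrix H) {c : K} (hc : Valued.v c ≤ 1) :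
    {q : (↥(unitaryGroupOfForm σ H) ⧸ ((glInt 3 K).subgroupOf (unitaryGroupOfForm σ H))) | q ∈ MulAction.fixedBy (↥(unitaryGroupOfForm σ H) ⧸ ((glInt 3 K).subgroupOf (unitaryGroupOfForm σ H))) γ ∧ ((redMat ((((q.out⁻¹ * γ * q.out) : ↥(unitaryGroupOfForm σ H)) : GL (Fin 3) K) : Matrix (Fin 3) (Fin 3) K) - 1).rank = 0 ∧ (redMat (ϖ⁻¹ • (((((q.out⁻¹ * γ * q.out) : ↥(unitaryGroupOfForm σ H)) : GL (Fin 3) K) : Matrix (Fin 3) (Fin 3) K) - 1))).rank = 1 ∧ ¬ ∃ (z : Fin 3 → 𝓀[K]) (a : 𝓀[K]), a ≠ 0 ∧ z ⬝ᵥ ((redMat H * redMat (ϖ⁻¹ • (((((q.out⁻¹ * γ * q.out) : ↥(unitaryGroupOfForm σ H)) : GL (Fin 3) K) : Matrix (Fin 3) (Fin 3) K) - 1))) *ᵥ z) = red c * a ^ 2)}.ncard =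
      {M : Submodule (Valued.integer K) (Fin 3 → K) | IsSelfDualLattice σ ϖ H M ∧ mapGL ((γ : ↥(unitaryGroupOfForm σ H)) : GL (Fin 3) K) M = M ∧ (M.map ((Matrix.toLin' ((((γ : ↥(unitaryGroupOfForm σ H)) : GL (Fin 3) K) : Matrix (Fin 3) (Fin 3) K) - 1)).restrictScalars (Valued.integer K)) ≤ scaleLattice ϖ M ∧ ¬ M.map ((Matrix.toLin' ((((γ : ↥(unitaryGroupOfForm σ H)) : GL (Fin 3) K) : Matrix (Fin 3) (Fin 3) K) - 1)).restrictScalars (Valued.integer K)) ≤ scaleLattice (ϖ ^ 2) M ∧ M.map ((Matrix.toLin' (((((γ : ↥(unitaryGroupOfForm σ H)) : GL (Fin 3) K) : Matrix (Fin 3) (Fin 3) K) - 1) ^ 2)).restrictScalars (Valued.integer K)) ≤ scaleLattice (ϖ ^ 3) M ∧ ¬ ∃ y ∈ M, ∃ a : K, Valued.v a = 1 ∧ Valued.v (ϖ⁻¹ * pairing σ H y (((((γ : ↥(unitaryGroupOfForm σ H)) : GL (Fin 3) K) : Matrix (Fin 3) (Fin 3) K) - 1) *ᵥ y) - c * a ^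 2) < 1)}.ncard := by
  refine ncard_fixedBy_quotient_sep_eq_ncard_selfDual_fixed_sep σ ϖ H hL₀ htrans γ
    (fun u => (redMat (((u : ↥(unitaryGroupOfForm σ H)) : GL (Fin 3) K) : Matrix (Fin 3) (Fin 3) K) - 1).rank = 0 ∧ (redMat (ϖ⁻¹ • ((((u : ↥(unitaryGroupOfForm σ H)) : GL (Fin 3) K) : Matrix (Fin 3) (Fin 3) K) - 1))).rank = 1 ∧ ¬ ∃ (z : Fin 3 → 𝓀[K]) (a : 𝓀[K]), a ≠ 0 ∧ z ⬝ᵥ ((redMat H * redMat (ϖ⁻¹ • ((((u : ↥(unitaryGroupOfForm σ H)) : GL (Fin 3) K) : Matrix (Fin 3) (Fin 3) K) - 1))) *ᵥ z) = red c * a ^ 2)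
    (fun M => M.map ((Matrix.toLin' ((((γ : ↥(unitaryGroupOfForm σ H)) : GL (Fin 3) K) : Matrix (Fin 3) (Fin 3) K) - 1)).restrictScalars (Valued.integer K)) ≤ scaleLattice ϖ M ∧ ¬ M.map ((Matrix.toLin' ((((γ : ↥(unitaryGroupOfForm σ H)) : GL (Fin 3) K) : Matrix (Fin 3) (Fin 3) K) - 1)).restrictScalars (Valued.integer K)) ≤ scaleLattice (ϖ ^ 2) M ∧ M.map ((Matrix.toLin' (((((γ : ↥(unitaryGroupOfForm σ H)) : GL (Fin 3) K) : Matrix (Fin 3) (Fin 3) K) - 1) ^ 2)).restrictScalars (Valued.integer K)) ≤ scaleLattice (ϖ ^ 3) M ∧ ¬ ∃ y ∈ M, ∃ a : K, Valued.v a = 1 ∧ Valued.v (ϖ⁻¹ * pairing σ H y (((((γ : ↥(unitaryGroupOfForm σ H)) : GL (Fin 3) K) : Matrix (Fin 3) (Fin 3) K) - 1) *ᵥ y) - c * a ^ 2) < 1) ?_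
  intro g hmem
  have hmem' : ((g : ↥(unitaryGroupOfForm σ H)) : GL (Fin 3) K)⁻¹ * ((γ : ↥(unitaryGroupOfForm σ H)) : GL (Fin 3) K) * ((g : ↥(unitaryGroupOfForm σ H)) : GL (Fin 3) K) ∈ glInt 3 K := hmem
  have e1 : (((g⁻¹ * γ * g : ↥(unitaryGroupOfForm σ H)) : GL (Fin 3) K) : Matrix (Fin 3) (Fin 3) K) = (((((g : ↥(unitaryGroupOfForm σ H)) : GL (Fin 3) K)⁻¹ * ((γ : ↥(unitaryGroupOfForm σ H)) : GL (Fin 3) K) * ((g : ↥(unitaryGroupOfForm σ H)) : GL (Fin 3) K) : GL (Fin 3) K)) : Matrix (Fin 3) (Fin 3) K) := rfl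
  have h0 := rank_redMat_sub_one_eq_zero_iff_map_sub_one_le hϖ hmem'
  have hd := fun hr0 => rank_redMat_inv_smul_sub_one_eq_zero_iff_map_sub_one_le_sq hϖ hmem' hr0
  have hs := fun hr0 => redMat_inv_smul_sub_one_mul_self_eq_zero_iff_map_sub_one_sq_le hϖ hmem' hr0
  have hN3 := fun hr0 => redMat_inv_smul_sub_one_pow_eq_zero_of_vDeep hϖ hdeep hmem' hr0
  have hcl := fun hr0 => exists_mem_mapGL_class_iff_residue σ hvσ hres hH hϖ γ g hmem hr0 hc
  rw [e1] at hcl ⊢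
  constructor
  · rintro ⟨hr0, hN1, hcls⟩
    obtain ⟨hsq, hne⟩ := (rank_eq_one_iff_mul_self_eq_zero_and_ne_zero_of_pow_eq_zero (hN3 hr0)).1 hN1
    exact ⟨h0.1 hr0, fun h => hne ((rank_eq_zero_iff_eq_zero _).1 ((hd hr0).2 h)), (hs hr0).1 hsq, fun h => hcls ((hcl hr0).1 h)⟩
  · rintro ⟨hlev, hn2, hlev2, hcls⟩
    have hr0 := h0.2 hlev
    refine ⟨hr0, (rank_eq_one_iff_mul_self_eq_zero_and_ne_zero_of_pow_eq_zero (hN3 hr0)).2 ⟨(hs hr0).2 hlev2, fun h => hn2 ((hd hr0).1 ?_)⟩, fun h => hcls ((hcl hr0).2 h)⟩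
    rw [h, Matrix.rank_zero]

end Counts


end Literature.NumberTheory.Automorphic.UnitaryLatticeTree

end
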